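import Mathlib
import Summits.MatrixMultiplication.Statement
import Summits.MatrixMultiplication.MatrixMultiplication.Theorems.GraphEquationsInitialIdeal
import Summits.MatrixMultiplication.MatrixMultiplication.Theorems.GraphEquationsExponentOne
import Summits.MatrixMultiplication.MatrixMultiplication.Theorems.GraphEquationsIsolationOpen

/-!
# GraphEquations — FINITE ORDER IS FREE: every correct system has a test ideal initially isolated
# to finite order over EVERY base; the membership exponent of the generators (M19b, decomp-mm-lens-5 g32)

(supports `MultiplicityReduction`, stmt-MatrixMultiplication-27806: locates the content of the
asymptotic-regime hand OR′ = `IsolationOrderReduction`.)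

The second hand of the `purisplit` line asks, for a cost-optimal family of correct systems, for
systems whose test IDEAL is initially isolated to some order `K` **chosen before `n`**
(`∃ K, EqAdmissibleIdealIso β' K`).  This module shows that the NON-UNIFORM version is free:

* `EqSystem.Correct.zeroLocus_span_tests` — for a correct system the zero locus of the test ideal
  `J_E = (t_o)_o` is the graph `W_n`;
* `EqSystem.Correct.exists_generator_pow_mem` / `exists_uniform_generator_pow_mem` — by Hilbert's
  Nullstellensatz (`MvPolynomial.vanishingIdeal_zeroLocus_eq_radical`) every generator
  `f_q = c_q − Σ_k a_{q₁k} b_{kq₂}` of `𝕀(W_n)` has a power in `J_E`, hence ONE exponent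
  `e = e(E) ≥ 1` with `f_q^e ∈ J_E` for all `q` — the MEMBERSHIP EXPONENT of `E`;
* `EqSystem.idealInitIsolatedAt_of_generator_pow_mem` — `f_q^e ∈ J_E (∀ q)`, `e ≥ 1` ⇒
  `IdealInitIsolatedAt e y` for EVERY base `y` (members `f_q^e`, `Ψ⁻¹ f_q^e = F_q^e`, pure forms `F_q^e`
  with the trivial common zero only);
* `EqSystem.Correct.exists_idealInitIsolatedAt` — **every correct system is ideal-initially-isolated to
  some finite order `K = e(E)` over every base.**

Consequences for the decomposition `MultiplicityReduction ⟸ OR′ ∧ BOP′` (D3 of the cell record):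
the statement "`EqAdmissible β → ∀ n, ∃ K(n), …`" carries no content; the WHOLE content of OR′ is the
UNIFORMITY of the isolation order along a cost-optimal family, and the finite range of BOP′ must
reach exactly `K* = sup_n K(E_n)` for the bridge to bite.  A sufficient, sharper currency is the
membership exponent: `eqAdmissibleIdealIso_of_generator_pow_mem` — cheap correct systems with
`f_q^e ∈ J_E` uniformly give `EqAdmissibleIdealIso β e`; with the tree's rung `K = 2`
(`boundedOrderPurification_two`) this yields the unconditional **SQUARE-MEMBERSHIP CRITERION**
`omega_le_of_generator_sq_mem`: if for every `n ≥ 1` there is a correct system of cost `≤ c·n^β`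
(`β ≥ 2`) whose test ideal contains every `f_q²`, then `ω ≤ β` — the tests themselves may be
arbitrarily non-reduced (compare module `GraphEquationsSquaredSystems`, where the tests ARE the
`f_q²` of a reduced system).

No `sorry`.  Sources: Hilbert's Nullstellensatz (Mathlib `RingTheory.Nullstellensatz`);
[Kollar1988] (effective exponents — why `e(E)` is not uniformly bounded for free: it grows with the
degrees of the tests); tree modules `GraphEquationsInitialIdeal` (M14b), `GraphEquationsExponentOne`,
`GraphEquationsIsolationOpen` (M18f).
-/

set_option linter.dupNamespace false

noncomputable section

open scoped BigOperators

namespace Summit.MatrixMultiplication.MatrixMultiplication.Theorems.GraphEquations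

open MvPolynomial
open Literature.Computability.AlgebraicComplexity

variable {n : ℕ}

namespace EqSystem

/-- For a correct system, the zero locus of the test ideal is the graph `W_n`. -/
theorem Correct.zeroLocus_span_tests {E : EqSystem n} (hE : E.Correct) :
    zeroLocus ℂ (Ideal.span (Set.range fun o : Fin E.tests.length => E.testPoly (E.tests.get o))) =
      mmGraph n := by
  rw [zeroLocus_span, ← hE.2]
  ext x
  simp only [Set.mem_setOf_eq, Set.forall_mem_range, zeroSet]
  constructor
  · intro h j hj
    obtain ⟨o, ho⟩ := List.mem_iff_get.1 hj
    have := h o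
    rwa [aeval_eq_eval, ho] at this
  · intro h o
    rw [aeval_eq_eval]
    exact h _ (List.get_mem _ _)

/-- **Nullstellensatz.**  For a correct system every generator `f_q` of `𝕀(W_n)` has a power in the
test ideal. -/
theorem Correct.exists_generator_pow_mem {E : EqSystem n} (hE : E.Correct) (q : Fin n × Fin n) :
    ∃ e : ℕ, generator n q ^ e ∈
      Ideal.span (Set.range fun o : Fin E.tests.length => E.testPoly (E.tests.get o)) := by
  have h : generator n q ∈ vanishingIdeal ℂ
      (zeroLocus ℂ (Ideal.span (Set.range fun o : Fin E.tests.length => E.testPoly (E.tests.get o)))) := by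
    rw [hE.zeroLocus_span_tests]
    obtain ⟨i, l⟩ := q
    exact generator_mem_vanishingIdeal i l
  rw [vanishingIdeal_zeroLocus_eq_radical] at h
  exact Ideal.mem_radical_iff.mp h

/-- **The membership exponent.**  For a correct system there is ONE exponent `e ≥ 1` with `f_q^e` in
the test ideal for every `q`. -/
theorem Correct.exists_uniform_generator_pow_mem {E : EqSystem n} (hE : E.Correct) :
    ∃ e : ℕ, 1 ≤ e ∧ ∀ q : Fin n × Fin n, generator n q ^ e ∈
      Ideal.span (Set.range fun o : Fin E.tests.length => E.testPoly (E.tests.get o)) := by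
  classical
  choose e he using hE.exists_generator_pow_mem
  refine ⟨Finset.univ.sup e + 1, by omega, fun q => ?_⟩
  have hle : e q ≤ Finset.univ.sup e := Finset.le_sup (Finset.mem_univ q)
  rw [show Finset.univ.sup e + 1 = e q + (Finset.univ.sup e + 1 - e q) by omega, pow_add]
  exact Ideal.mul_mem_right _ _ (he q)

/-- **Powers of the generators in the test ideal give ideal isolation of that order over EVERY base**:
the members `f_q^e` have `Ψ⁻¹ f_q^e = F_q^e`, pure forms with the trivial common zero only. -/
theorem idealInitIsolatedAt_of_generator_pow_mem (E : EqSystem n) {e : ℕ} (he : 1 ≤ e)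
    (h : ∀ q : Fin n × Fin n, generator n q ^ e ∈
      Ideal.span (Set.range fun o : Fin E.tests.length => E.testPoly (E.tests.get o)))
    (y : MatMulVars n → ℂ) : E.IdealInitIsolatedAt e y := by
  classical
  let ε : Fin (Fintype.card (Fin n × Fin n)) ≃ Fin n × Fin n := (Fintype.equivFin (Fin n × Fin n)).symm
  refine ⟨Fintype.card (Fin n × Fin n), fun i => generator n (ε i) ^ e, fun i => h _, ?_⟩
  refine ⟨fun _ => e, fun i => X (ε i) ^ e, fun _ => le_rfl, fun i => ?_, fun i j hj => ?_, fun F₀ hF => ?_⟩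
  · rw [map_pow, substF_X]
  · have hj' : j < e := hj
    rw [homogeneousComponent_of_mem ((mem_homogeneousSubmodule _ _).mpr (isHomogeneous_X_pow (ε i) e)),
      if_neg (by omega)]
  · funext q
    have hq := hF (ε.symm q)
    simp only [Equiv.apply_symm_apply,
      homogeneousComponent_of_mem ((mem_homogeneousSubmodule _ _).mpr (isHomogeneous_X_pow q e)),
      if_true, map_pow, map_X, eval_X, Pi.zero_apply, zero_pow (by omega : e ≠ 0)] at hq
    exact eq_zero_of_pow_eq_zero hq

/-- **FINITE ORDER IS FREE.**  Every correct system has a test ideal initially isolated to some finite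
order `K ≥ 1` over EVERY base `y`. -/
theorem Correct.exists_idealInitIsolatedAt {E : EqSystem n} (hE : E.Correct) :
    ∃ K : ℕ, 1 ≤ K ∧ ∀ y : MatMulVars n → ℂ, E.IdealInitIsolatedAt K y := by
  obtain ⟨e, he, h⟩ := hE.exists_uniform_generator_pow_mem
  exact ⟨e, he, idealInitIsolatedAt_of_generator_pow_mem E he h⟩

end EqSystem

/-! ## The membership-exponent currency -/

/-- **Uniform membership exponent ⇒ uniform isolation order.**  Correct systems of cost `O(n^β)` whose
test ideals contain every `f_q^e` (one `e ≥ 1` for all `n`) witness `EqAdmissibleIdealIso β e`. -/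
theorem eqAdmissibleIdealIso_of_generator_pow_mem {β : ℝ} {e : ℕ} (he : 1 ≤ e)
    (h : ∃ c : ℝ, ∀ n : ℕ, 1 ≤ n → ∃ E : EqSystem n, E.Correct ∧
      (∀ q : Fin n × Fin n, generator n q ^ e ∈
        Ideal.span (Set.range fun o : Fin E.tests.length => E.testPoly (E.tests.get o))) ∧
      (E.cost : ℝ) ≤ c * (n : ℝ) ^ β) :
    EqAdmissibleIdealIso β e := by
  obtain ⟨c, hc⟩ := h
  refine ⟨c, fun n hn => ?_⟩
  obtain ⟨E, hE, hmem, hcost⟩ := hc n hn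
  exact ⟨E, hE, ⟨0, E.idealInitIsolatedAt_of_generator_pow_mem he hmem 0⟩, hcost⟩

/-- For every `n ≥ 1` and every admissible exponent there is a correct cheap system with SOME isolation
order `K(n) ≥ 1` over every base — the non-uniform shadow of `IsolationOrderReduction`, which is
therefore free; the content of OR′ is the uniformity of `K` in `n`. -/
theorem exists_idealInitIsolatedAt_of_eqAdmissible {β : ℝ} (h : EqAdmissible β) :
    ∃ c : ℝ, ∀ n : ℕ, 1 ≤ n → ∃ E : EqSystem n, E.Correct ∧
      (∃ K : ℕ, 1 ≤ K ∧ ∀ y : MatMulVars n → ℂ, E.IdealInitIsolatedAt K y) ∧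
      (E.cost : ℝ) ≤ c * (n : ℝ) ^ β := by
  obtain ⟨c, hc⟩ := h
  refine ⟨c, fun n hn => ?_⟩
  obtain ⟨E, hE, hcost⟩ := hc n hn
  exact ⟨E, hE, hE.exists_idealInitIsolatedAt, hcost⟩

/-- **SQUARE-MEMBERSHIP CRITERION (unconditional, via rung `K = 2`).**  If for some `β ≥ 2` and every
`n ≥ 1` there is a correct system of cost `≤ c·n^β` whose test ideal contains the SQUARE of every
generator `f_q`, then `ω ≤ β`. -/
theorem omega_le_of_generator_sq_mem {β : ℝ} (hβ : 2 ≤ β)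
    (h : ∃ c : ℝ, ∀ n : ℕ, 1 ≤ n → ∃ E : EqSystem n, E.Correct ∧
      (∀ q : Fin n × Fin n, generator n q ^ 2 ∈
        Ideal.span (Set.range fun o : Fin E.tests.length => E.testPoly (E.tests.get o))) ∧
      (E.cost : ℝ) ≤ c * (n : ℝ) ^ β) :
    omega ℂ ≤ β := by
  have hiso : EqAdmissibleIdealIso β 2 := eqAdmissibleIdealIso_of_generator_pow_mem (by norm_num) h
  refine le_of_forall_gt_imp_ge_of_dense fun β' hβ' => ?_
  exact (boundedOrderPurification_two β hβ hiso β' hβ').omega_le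

end Summit.MatrixMultiplication.MatrixMultiplication.Theorems.GraphEquations

end
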